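import Summits.CriticalPhenomena.PercolationContinuityZ3.Theorems.SahiMasterFamilyFCombShiftMatching
import Summits.CriticalPhenomena.PercolationContinuityZ3.Theorems.SahiMasterFamilyFCombRelShiftDet

/-!
# Kleitman–Hall survives relative down-compression (LEMMA I** of the one-shared-coordinate programme — support file)

Support file (prover seat `prim-bnk-2`, gen 31; `--supports stmt-CriticalPhenomena-4575`).  Memo:
`run/shared/lean/prim/prim-l12/FROM-prim-bnk-2-g31-COMPRESSION-THEOREM.md` §1 (Lemma 4 + Corollary (L*)).

**`exists_dominating_equiv_relDowns`.**  For up-closed `P ⊆ Q` (`Q` convex) in a finite cube and any list `l` of distinct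
coordinates there is a bijection `φ : σP ≃ D^Q_l P` (`σ` = complementation, `D^Q_l` = iterated down-compression RELATIVE to
`Q`, file `…RelCompressionDefs`) with `x ⊆ φ x`.  `l = []` is Kleitman–Hall (`σP → P`); for `Q = univ` and a full list
`D_l P = σP` and `φ = id`.  Proof: the domination matrix `([x ⊆ κ x'])_{x,x' ∈ σP}` factors as `ζ[σP,σP]ᵀ · Λ · ζ[D^Q_l P, P]ᵀ`
(binomial identity over the down-set `σP`), so its determinant is a unit by THEOREM S^rel
(`isUnit_det_incl_relDowns`); a nonzero Leibniz term is the bijection (pattern of `exists_disjoint_equiv`).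
Also: monotonicity of (iterated) relative compression in the family, hence the explicit LEMMA-I** up-set
`T(P) = Q \\ D^Q_l P` is antitone in `P` (`sdiff_relDowns_antitone`; coherent / nested solutions, memo COH).
No definitions; no `sorry`; standard axioms.
-/

namespace Summit.CriticalPhenomena.PercolationContinuityZ3.Theorems

namespace SahiFComb.Shift

open Finset FinsetFamily Matrix

variable {α : Type*} [DecidableEq α]

/-! ### Kleitman–Hall survives relative compression -/

/-- **Kleitman–Hall survives relative down-compression** (prim-bnk-2 g31, memo FROM-prim-bnk-2-g31-COMPRESSION-THEOREM.md,
Corollary (L*)).  Let `P ⊆ Q` be families in a finite cube, `P` up-closed, `Q` convex, `l` a list of distinct coordinates and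
`P* = D^Q_l P` the iterated relative down-compression of `P` inside `Q`.  Then there is a bijection `φ : σP ≃ P*`
(`σ` = complementation) with `x ⊆ φ x` for every `x`.  (`l = []`: Kleitman–Hall `σP → P`; `Q = univ`, `l` full: the identity
`σP = D_l P`.)  Proof: the domination matrix `([x ⊆ κ x'])` factors as `ζ[σP,σP]ᵀ · Λ · ζ[P*, P]ᵀ` (binomial identity over the
down-set `σP`), so its determinant is a unit by THEOREM S^rel; a nonzero Leibniz term is the bijection. [this work] -/
theorem exists_dominating_equiv_relDowns [Fintype α] [LinearOrder α] (Q P : Finset (Finset α))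
    (hQ : ∀ ⦃F G K : Finset α⦄, F ∈ Q → G ∈ Q → F ⊆ K → K ⊆ G → K ∈ Q)
    (hP : ∀ K ∈ P, ∀ K', K ⊆ K' → K' ∈ P) (hPQ : P ⊆ Q) (l : List α) (hl : l.Nodup)
    (Pstar : Finset (Finset α)) (hPstar : Pstar = l.foldl (fun 𝒴 i => relCompression Q i 𝒴) P) :
    ∃ φ : ↥(P.image compl) ≃ ↥Pstar, ∀ x : ↥(P.image compl), (x : Finset α) ⊆ ((φ x : ↥Pstar) : Finset α) := by
  set S := P.image compl with hSdef
  have hmemS : ∀ K : Finset α, K ∈ S ↔ Kᶜ ∈ P := by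
    intro K
    rw [hSdef, mem_image]
    constructor
    · rintro ⟨K', hK', rfl⟩; rwa [compl_compl]
    · intro h; exact ⟨Kᶜ, h, compl_compl K⟩
  have hS : ∀ K ∈ S, ∀ K' ⊆ K, K' ∈ S := fun K hK K' hK' =>
    (hmemS K').2 (hP _ ((hmemS K).1 hK) _ (compl_subset_compl.2 hK'))
  -- complementation `S ≃ P` and a bijection `P ≃ P*`
  let c : ↥S ≃ ↥P :=
    { toFun := fun y => ⟨(y : Finset α)ᶜ, (hmemS _).1 y.2⟩
      invFun := fun w => ⟨(w : Finset α)ᶜ, (hmemS _).2 (by rw [compl_compl]; exact w.2)⟩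
      left_inv := fun y => Subtype.ext (compl_compl _)
      right_inv := fun w => Subtype.ext (compl_compl _) }
  have hcard : Fintype.card ↥P = Fintype.card ↥Pstar := by
    simp only [Fintype.card_coe, hPstar, card_relDowns]
  let e : ↥P ≃ ↥Pstar := Fintype.equivOfCardEq hcard
  have hSrel : IsUnit ((incl Pstar P).submatrix e id).det := by
    have key : ∀ (X : Finset (Finset α)), X = l.foldl (fun 𝒴 i => relCompression Q i 𝒴) P →
        ∀ e' : ↥P ≃ ↥X, IsUnit ((incl X P).submatrix e' id).det := by
      intro X hX e'; subst hX; exact isUnit_det_incl_relDowns l hl Q hQ P hPQ e'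
    exact key Pstar hPstar e
  let κ : ↥S ≃ ↥Pstar := c.trans e
  -- the domination matrix and its factorisation
  let DS : Matrix ↥S ↥S ℤ := Matrix.of fun x x' => if (x : Finset α) ⊆ (κ x' : Finset α) then 1 else 0
  have hDS : DS = (incl S S)ᵀ * Matrix.diagonal (fun F : ↥S => (-1 : ℤ) ^ #(F : Finset α)) *
      (((incl Pstar P).submatrix e id).submatrix c c)ᵀ := by
    ext x x'
    rw [Matrix.mul_apply]
    simp only [DS, Matrix.of_apply, Matrix.mul_diagonal, Matrix.transpose_apply, incl_apply, submatrix_apply, id_eq]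
    have hκ : ∀ y : ↥S, ((κ y : ↥Pstar) : Finset α) = ((e (c y) : ↥Pstar) : Finset α) := fun _ => rfl
    have hc : ∀ y : ↥S, ((c y : ↥P) : Finset α) = (y : Finset α)ᶜ := fun _ => rfl
    simp only [hκ, hc]
    -- the binomial identity over the down-set `S`
    rw [Finset.sum_coe_sort S (fun F => (if F ⊆ (x : Finset α) then (1 : ℤ) else 0) * (-1) ^ #F *
      (if ((e (c x') : ↥Pstar) : Finset α) ⊆ Fᶜ then 1 else 0))]
    have h1 : ∀ F ∈ S, (if F ⊆ (x : Finset α) then (1 : ℤ) else 0) * (-1) ^ #F *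
        (if ((e (c x') : ↥Pstar) : Finset α) ⊆ Fᶜ then 1 else 0) =
        if F ⊆ (x : Finset α) ∩ ((e (c x') : ↥Pstar) : Finset α)ᶜ then (-1) ^ #F else 0 := by
      intro F _
      have hiff : ((e (c x') : ↥Pstar) : Finset α) ⊆ Fᶜ ↔ F ⊆ ((e (c x') : ↥Pstar) : Finset α)ᶜ :=
        ⟨fun h => subset_compl_comm.1 h, fun h => subset_compl_comm.1 h⟩
      by_cases h : F ⊆ (x : Finset α) ∩ ((e (c x') : ↥Pstar) : Finset α)ᶜ
      · rw [if_pos h, if_pos (h.trans inter_subset_left), if_pos (hiff.2 (h.trans inter_subset_right))]; ring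
      · rw [if_neg h]
        by_cases h' : F ⊆ (x : Finset α)
        · rw [if_neg (show ¬ ((e (c x') : ↥Pstar) : Finset α) ⊆ Fᶜ from
            fun h'' => h (subset_inter h' (hiff.1 h'')))]; ring
        · rw [if_neg h']; ring
    rw [Finset.sum_congr rfl h1, ← Finset.sum_filter]
    have h2 : S.filter (fun F => F ⊆ (x : Finset α) ∩ ((e (c x') : ↥Pstar) : Finset α)ᶜ) =
        ((x : Finset α) ∩ ((e (c x') : ↥Pstar) : Finset α)ᶜ).powerset := by
      ext F
      simp only [mem_filter, mem_powerset]
      exact ⟨fun h => h.2, fun h => ⟨hS _ x.2 F (h.trans inter_subset_left), h⟩⟩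
    rw [h2, Finset.sum_powerset_neg_one_pow_card]
    have h3 : (x : Finset α) ⊆ ((e (c x') : ↥Pstar) : Finset α) ↔
        (x : Finset α) ∩ ((e (c x') : ↥Pstar) : Finset α)ᶜ = ∅ := by
      rw [← disjoint_iff_inter_eq_empty, disjoint_compl_right_iff]
    exact if_congr h3 rfl rfl
  have hDSunit : IsUnit DS.det := by
    rw [hDS, Matrix.det_mul, Matrix.det_mul, Matrix.det_transpose, det_incl_self, one_mul, Matrix.det_diagonal,
      Matrix.det_transpose, Matrix.det_submatrix_equiv_self]
    exact (isUnit_prod_neg_one_pow _).mul hSrel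
  -- Leibniz: a nonzero permutation term is a perfect matching of the domination relation
  have hne : DS.det ≠ 0 := hDSunit.ne_zero
  rw [Matrix.det_apply'] at hne
  obtain ⟨σ, -, hσ⟩ := Finset.exists_ne_zero_of_sum_ne_zero hne
  have hσ' : ∀ i : ↥S, DS (σ i) i ≠ 0 := fun i =>
    (Finset.prod_ne_zero_iff.1 (mul_ne_zero_iff.1 hσ).2) i (Finset.mem_univ _)
  refine ⟨σ.symm.trans κ, fun x => ?_⟩
  have hx := hσ' (σ.symm x)
  rw [Equiv.apply_symm_apply] at hx
  simp only [DS, Matrix.of_apply, ne_eq, ite_eq_right_iff, one_ne_zero, imp_false, not_not] at hx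
  exact hx

/-! ### Coherence: the explicit solution is antitone in `P` -/

/-- Relative down-compression is monotone in the family (fixed ambient). [this work] -/
theorem relCompression_mono {Q 𝒜 ℬ : Finset (Finset α)} (a : α) (h : 𝒜 ⊆ ℬ) :
    relCompression Q a 𝒜 ⊆ relCompression Q a ℬ := by
  intro z hz
  rw [mem_relCompression] at hz ⊢
  rcases hz with ⟨hz𝒜, hz'⟩ | ⟨hz𝒜, hins, hzQ⟩
  · refine Or.inl ⟨h hz𝒜, ?_⟩
    rcases hz' with hz' | hz'
    · exact Or.inl (h hz')
    · exact Or.inr hz'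
  · have haz : a ∉ z := fun haz => hz𝒜 (by rwa [insert_eq_of_mem haz] at hins)
    by_cases hzℬ : z ∈ ℬ
    · exact Or.inl ⟨hzℬ, Or.inl (by rwa [erase_eq_of_notMem haz])⟩
    · exact Or.inr ⟨hzℬ, h hins, hzQ⟩

/-- Iterated relative down-compression is monotone in the family. [this work] -/
theorem relDowns_mono (Q : Finset (Finset α)) :
    ∀ (l : List α) (𝒜 ℬ : Finset (Finset α)), 𝒜 ⊆ ℬ →
      l.foldl (fun 𝒴 i => relCompression Q i 𝒴) 𝒜 ⊆ l.foldl (fun 𝒴 i => relCompression Q i 𝒴) ℬ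
  | [], _, _, h => h
  | a :: l, _, _, h => relDowns_mono Q l _ _ (relCompression_mono a h)

/-- **Coherence (COH, memo §0).** The explicit LEMMA-I** up-set `T(P) = Q \\ D^Q_l P` is ANTITONE in `P`: for
`P ⊆ P'` one has `T(P') ⊆ T(P)`.  Hence along any chain of up-sets `Q = P₀ ⊋ P₁ ⊋ … ⊋ ∅` the solutions are nested (the
`BIEXT` / nested-chain structure of the memo, §3). [this work] -/
theorem sdiff_relDowns_antitone (Q : Finset (Finset α)) (l : List α) {P P' : Finset (Finset α)} (h : P ⊆ P') :
    Q \ l.foldl (fun 𝒴 i => relCompression Q i 𝒴) P' ⊆ Q \ l.foldl (fun 𝒴 i => relCompression Q i 𝒴) P :=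
  sdiff_subset_sdiff (Subset.refl Q) (relDowns_mono Q l P P' h)

end SahiFComb.Shift

end Summit.CriticalPhenomena.PercolationContinuityZ3.Theorems
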